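/-
Copyright (c) 2026. All rights reserved.
Released under Apache 2.0 license as described in the file LICENSE.
Authors: abc-iut cell, seat abc-iut-f-069 (gen 7; row «CT2b / G-L4t6g8-2 residual», file 4 of 5).
-/
import Literature.AnabelianGeometry.AbsoluteAnabelian.AbsTopII.DehnTwistAffineOrbits
import HarnessLib

/-!
# Invariant Fox chains under a free pro-cyclic affine dynamics vanish (two `Ẑ`-measure theorems for `F̂₂ ⊂ Π_I`)

S. Mochizuki, *Topics in Absolute Anabelian Geometry II* [AbsTopII] (`MochizukiAbsTopII2013`) §1 Prop 1.3 (viii) p. 12,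
at the nodal Dehn-twist datum (abc-iut-L4-t6 `DehnTwistLoopDatum`: `Π_𝔾 = F̂₂`, `Π_e = b^Ẑ`, `Π_v = ⟨b^Ẑ, ab^Ẑa⁻¹⟩^`,
`Π_I = F̂₂ ⋊_{shear^i} Ẑ`); Lyndon–Schupp Ch. II §3 (Fox calculus) [cite: LyndonSchupp2001, Ch. II §3].
PROOF-ONLY file (no definition, no instance, no notation), abc-iut-f-069 (gen 7); file 4 of the chain closing the
residual «CT2» of GAP row G-L4t6g8-2 (hypothesis of L4-t6's `prop_1_3_viii′_dpsc_of_CT2`, p487638).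
SETTING: `U, K : Ẑ → Ẑ` continuous (`u = U(1)`, `k = K(1)`), `x ∈ F̂₂` with the MIXED-TWIST EQUATION
`shear^i(k) x = b^{-u} · x · b^{P}` (CT2: `P = u`; twisted fixed points: `u = 1`); `σ_ν(y) = b^{Uν} · shear^i(Kν)(y)`;
`ℓ`-FREENESS at `y` := no `ν ≠ 1` divisible by every `r` prime to `ℓ` has `σ_ν(y) = y`.
* `fox_fst_invariant_of_shear_eq_conj` — every level `a`-chain of `x` is invariant under `h ↦ z̄ h τ̄⁻¹`;
* `fox_fst_apply_eq_zero_of_free` — **VANISH**: if every lift of `ḡ ∈ Π_I/V` is `ℓ`-free, the `a`-chain dies at `ḡ`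
  (period growth + uniformisation (file 3), then the orbit-count test `FoxChain.sum_eq_zero_of_dvd_minimalPeriod`);
* `mem_nodeGp_of_shear_eq_conj_of_free` — **FREE EVERYWHERE ⇒ `x ∈ b^Ẑ`**;
  `mem_vertGp_or_of_shear_eq_conj_of_free_off` — **FREE OFF `Π_v` ⇒ `x ∈ Π_v` or `x ∈ Π_v·a·b^Ẑ`**.
HONEST FRAMING: classical profinite group theory (Fox calculus in finite quotients; `Ẑ` has no divisible elements) under
OUR kernel check, at a constructed model (constructed ≠ geometric); nothing here bears on [IUTchIII] Cor 3.12; no side taken.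
-/

noncomputable section

open scoped Pointwise

namespace Literature.AnabelianGeometry.AbsoluteAnabelian.AbsTopII.DehnTwist

open Literature.AnabelianGeometry.EtaleTheta.SettingModel
open Literature.AnabelianGeometry.EtaleTheta
open Literature.AnabelianGeometry.AbsoluteAnabelian
open Literature.GroupTheory.CombinatorialGroupTheory.FoxChain
open Function _root_.Topology

variable {i : ℕ}

/-! ### §0 `Π_I/V` bookkeeping and the compactness step for subsets of `F̂₂` -/

/-- `conj(τ̄)` (`τ̄` the image of `(1,k')` in `Π_I/V`) FIXES the image of `b`. [cite: MochizukiAbsTopII2013, Prop 1.3 (ii) p.11] -/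
theorem conj_mk_inr_genB (V : OpenNormalSubgroup (Ext i)) (k' : ZH) :
    MulAut.conj (QuotientGroup.mk' V.toSubgroup (SemidirectProduct.inr k') : Ext i ⧸ V.toSubgroup)
        (QuotientGroup.mk' V.toSubgroup (SemidirectProduct.inl genB)) =
      QuotientGroup.mk' V.toSubgroup (SemidirectProduct.inl genB) := by
  rw [MulAut.conj_apply, mk_inr_conj]
  change QuotientGroup.mk' V.toSubgroup (SemidirectProduct.inl (shearPow i k' (eta (FreeGroup.of 1)))) = _
  rw [shearPow_eta_one]

/-- `conj(τ̄)` sends the image `α` of `a` to `α · (image of b^{k'^i})`. [cite: MochizukiAbsTopII2013, Prop 1.3 (ii) p.11] -/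
theorem conj_mk_inr_genA (V : OpenNormalSubgroup (Ext i)) (k' : ZH) :
    MulAut.conj (QuotientGroup.mk' V.toSubgroup (SemidirectProduct.inr k') : Ext i ⧸ V.toSubgroup)
        (QuotientGroup.mk' V.toSubgroup (SemidirectProduct.inl genA)) =
      QuotientGroup.mk' V.toSubgroup (SemidirectProduct.inl genA) *
        QuotientGroup.mk' V.toSubgroup (SemidirectProduct.inl (bPow (k' ^ i))) := by
  rw [MulAut.conj_apply, mk_inr_conj]
  change QuotientGroup.mk' V.toSubgroup (SemidirectProduct.inl (shearPow i k' (eta (FreeGroup.of 0)))) = _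
  rw [shearPow_eta_zero, map_mul, map_mul]

/-- The image of a closed subset `C ⊆ F̂₂` under `inl` is closed in `Π_I`. [cite: MochizukiAbsTopII2013, Def 1.2 (ii) p.10] -/
theorem isClosed_image_inl {C : Set F₂hatT} (hC : IsClosed C) :
    IsClosed ((SemidirectProduct.inl : F₂hatT → Ext i) '' C) :=
  (hC.isCompact.image (continuous_inl i)).isClosed

/-- **Compactness step** `⋂_V C·V = C` for a closed `C ⊆ F̂₂`, read in `Π_I`. [cite: RibesZalesskii2010, Lemma 3.2.1] -/
theorem mem_of_forall_exists_inl_inv_mul_mem {C : Set F₂hatT} (hC : IsClosed C) {x : F₂hatT}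
    (h : ∀ V : OpenNormalSubgroup (Ext i), ∃ p ∈ C,
      (SemidirectProduct.inl p : Ext i)⁻¹ * SemidirectProduct.inl x ∈ (V : Set (Ext i))) : x ∈ C := by
  have hmem : (SemidirectProduct.inl x : Ext i) ∈ (SemidirectProduct.inl : F₂hatT → Ext i) '' C := by
    refine mem_of_forall_exists_inv_mul_mem (isClosed_image_inl hC) fun V => ?_
    obtain ⟨p, hp, hpV⟩ := h V
    exact ⟨SemidirectProduct.inl p, ⟨p, hp, rfl⟩, hpV⟩
  obtain ⟨p, hp, hpx⟩ := hmem
  rw [← SemidirectProduct.inl_injective hpx]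
  exact hp

/-- Every element of `Π_I` is `(y, s) = (y,1)·(1,s)`; the action `σ_ν` on it reduces to `F̂₂`:
`(b^{Uν}, Kν) · (y,s) · (1,Kν)⁻¹ = (y,s)` iff `b^{Uν} · shear^i(Kν)(y) = y`. [cite: MochizukiAbsTopII2013, Def 1.2 (ii) p.10] -/
theorem act_eq_self_iff (U K : ZH →ₜ* ZH) (ν : ZH) (g : Ext i) :
    (SemidirectProduct.inl (bPow (U ν)) * SemidirectProduct.inr (K ν) : Ext i) * g * (SemidirectProduct.inr (K ν))⁻¹ = g ↔
      bPow (U ν) * shearPow i (K ν) g.left = g.left := by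
  conv_lhs => rw [← SemidirectProduct.inl_left_mul_inr_right g]
  have hcomm : K ν * g.right * (K ν)⁻¹ = g.right := by
    rw [ZHatCompletion.mul_comm (K ν) g.right, mul_inv_cancel_right]
  constructor
  · intro h
    have h1 := congrArg SemidirectProduct.left h
    simp only [SemidirectProduct.mul_left, SemidirectProduct.mul_right, SemidirectProduct.inv_left,
      SemidirectProduct.left_inl, SemidirectProduct.right_inl, SemidirectProduct.left_inr, SemidirectProduct.right_inr,
      map_one, mul_one, one_mul, map_mul, inv_one, map_inv] at h1
    simpa using h1
  · intro h
    refine SemidirectProduct.ext ?_ ?_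
    · simp only [SemidirectProduct.mul_left, SemidirectProduct.mul_right, SemidirectProduct.inv_left,
        SemidirectProduct.left_inl, SemidirectProduct.right_inl, SemidirectProduct.left_inr, SemidirectProduct.right_inr,
        map_one, mul_one, one_mul, map_mul, inv_one, map_inv]
      simpa using h
    · simp only [SemidirectProduct.mul_right, SemidirectProduct.inv_right, SemidirectProduct.right_inl,
        SemidirectProduct.right_inr, one_mul, hcomm]

/-! ### §1 The mixed-twist equation makes every level chain invariant under `h ↦ z̄ h τ̄⁻¹` -/

section Invariance

variable {G : Type} [Group G] [Fintype G] [DecidableEq G]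
variable {k : Type} [CommRing k] [TopologicalSpace (W G k)] [DiscreteTopology (W G k)]
variable {α β : G} {Φ : F₂hatT →ₜ* W G k}

/-- **INVARIANCE (mixed form).** If `shear_κ x = b^{-u} x b^{P}` then the `a`-chain `f` of `x` satisfies
`f (β^{n_u} · γ h) = f h` (`Φ(b^u) = (wb β)^{n_u}`; `γ α = α β^n`, `γ β = β`). [cite: LyndonSchupp2001, Ch. II §3] -/
theorem fox_fst_invariant_of_shear_eq_conj (hΦa : Φ genA = wa α) (hΦb : Φ genB = wb β) (κ u P : ZH) (γ : G ≃* G)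
    (n nu : ℕ) (hγa : γ α = α * β ^ n) (hγb : γ β = β) (hκ : Φ (bPow κ) = wb β ^ n) (hu : Φ (bPow u) = wb β ^ nu)
    {x : F₂hatT} (hx : shearEnd κ x = (bPow u)⁻¹ * x * bPow P) (h : G) :
    (Multiplicative.toAdd (Φ x).left).1 (β ^ nu * γ h) = (Multiplicative.toAdd (Φ x).left).1 h := by
  set f := (Multiplicative.toAdd (Φ x).left).1 with hfdef
  have hx' : x = bPow u * shearEnd κ x * (bPow P)⁻¹ := by rw [hx]; group
  have hΦx : Φ x = Φ (bPow u) * mapW γ.toMonoidHom (thetaHom (α * (β ^ n)⁻¹) β n (Φ x)) * (Φ (bPow P))⁻¹ := by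
    conv_lhs => rw [hx']
    rw [map_mul, map_mul, map_inv, fox_shearEnd_eq hΦa hΦb κ γ.toMonoidHom n (by exact hγa) (by exact hγb) hκ x]
  have h0 := congrArg (fun w : W G k => (Multiplicative.toAdd w.left).1) hΦx
  have h1 : (Multiplicative.toAdd (Φ (bPow u) * mapW γ.toMonoidHom (thetaHom (α * (β ^ n)⁻¹) β n (Φ x)) *
      (Φ (bPow P))⁻¹).left).1 = lt (β ^ nu) (push (⇑γ) f) := by
    rw [SemidirectProduct.mul_left, toAdd_mul, toAdd_foxAct, Prod.fst_add, fst_eq_zero_inv (fox_bPow_fst_eq_zero hΦb P),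
      lt_zero, add_zero, SemidirectProduct.mul_left, toAdd_mul, toAdd_foxAct, Prod.fst_add, fox_bPow_fst_eq_zero hΦb u,
      zero_add, hu, wb_pow_right, toAdd_mapW_left]
    show lt (β ^ nu) (push (⇑γ.toMonoidHom) (Multiplicative.toAdd (thetaHom (α * (β ^ n)⁻¹) β n (Φ x)).left).1) = _
    rw [thetaHom_fst]
    rfl
  have hf : f = lt (β ^ nu) (push (⇑γ) f) := h0.trans h1
  have h2 := congrFun hf (β ^ nu * γ h)
  rw [h2, lt_apply, inv_mul_cancel_left]
  exact push_apply_of_injective (⇑γ) γ.injective f h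

end Invariance

/-! ### §2 VANISH: the chain at a level dies at every point all of whose lifts are `ℓ`-free -/

/-- **VANISH.**  If `x` satisfies the mixed-twist equation and every lift `(y,s)` of `ḡ ∈ Π_I/V` is `ℓ`-free, the level-`V`
`a`-chain of `x` vanishes at `ḡ` (finer level with all periods over `ḡ` divisible by `ℓ·`period(`ḡ`); invariance; the
pushforward is a sum over cycles of lengths `≡ 0 (mod ℓ)`). [cite: LyndonSchupp2001, Ch. II §3] -/
theorem fox_fst_apply_eq_zero_of_free {ℓ : ℕ} [hℓ : Fact ℓ.Prime] (U K : ZH →ₜ* ZH) (P : ZH) {x : F₂hatT}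
    (hx : shearPow i (K (iotaZ (Multiplicative.ofAdd 1))) x =
      (bPow (U (iotaZ (Multiplicative.ofAdd 1))))⁻¹ * x * bPow P)
    (V : OpenNormalSubgroup (Ext i)) [DecidableEq (Ext i ⧸ V.toSubgroup)]
    [TopologicalSpace (W (Ext i ⧸ V.toSubgroup) (ZMod ℓ))] [DiscreteTopology (W (Ext i ⧸ V.toSubgroup) (ZMod ℓ))]
    {Φ : F₂hatT →ₜ* W (Ext i ⧸ V.toSubgroup) (ZMod ℓ)}
    (hΦa : Φ genA = wa (QuotientGroup.mk' V.toSubgroup (SemidirectProduct.inl genA)))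
    (hΦb : Φ genB = wb (QuotientGroup.mk' V.toSubgroup (SemidirectProduct.inl genB)))
    (gbar : Ext i ⧸ V.toSubgroup)
    (hfree : ∀ (y : F₂hatT) (s : ZH),
      QuotientGroup.mk' V.toSubgroup (SemidirectProduct.inl y * SemidirectProduct.inr s) = gbar →
        ∀ ν : ZH, (∀ r : ℕ, 0 < r → ℓ.Coprime r → ∃ μ : ZH, μ ^ r = ν) →
          bPow (U ν) * shearPow i (K ν) y = y → ν = 1) :
    (Multiplicative.toAdd (Φ x).left).1 gbar = 0 := by
  classical
  set ι₁ : ZH := iotaZ (Multiplicative.ofAdd 1) with hι₁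
  set u : ZH := U ι₁ with hu
  set kk : ZH := K ι₁ with hkk
  -- the one-parameter groups `Z(ν) = (b^{Uν}, Kν)` and `T(ν) = (1, Kν)`
  let T : ZH →ₜ* Ext i :=
    { toFun := fun ν => SemidirectProduct.inr (K ν)
      map_one' := by rw [map_one, map_one]
      map_mul' := fun a b => by rw [map_mul, map_mul]
      continuous_toFun := (continuous_inr i).comp K.continuous }
  let Z : ZH →ₜ* Ext i :=
    { toFun := fun ν => SemidirectProduct.inl (bPow (U ν)) * SemidirectProduct.inr (K ν)
      map_one' := by rw [map_one, map_one, map_one, map_one, map_one, mul_one]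
      map_mul' := fun a b => by
        refine SemidirectProduct.ext ?_ ?_
        · simp only [SemidirectProduct.mul_left, SemidirectProduct.mul_right, SemidirectProduct.left_inl,
            SemidirectProduct.right_inl, SemidirectProduct.left_inr, SemidirectProduct.right_inr, map_one, map_mul,
            mul_one, one_mul, MulAut.one_apply, shearPow_bPow]
        · simp only [SemidirectProduct.mul_right, SemidirectProduct.right_inl, SemidirectProduct.right_inr, map_mul,
            one_mul, mul_one]
      continuous_toFun := ((continuous_inl i).comp (bPow.continuous.comp U.continuous)).mul
        ((continuous_inr i).comp K.continuous) }
  have hZ1 : Z ι₁ = SemidirectProduct.inl (bPow u) * SemidirectProduct.inr kk := rfl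
  have hT1 : T ι₁ = SemidirectProduct.inr kk := rfl
  set z : Ext i := SemidirectProduct.inl (bPow u) * SemidirectProduct.inr kk with hz
  set τ : Ext i := SemidirectProduct.inr kk with hτ
  -- freeness on the fibre, in `Π_I`-form
  have hfreeE : ∀ g : Ext i, QuotientGroup.mk' V.toSubgroup g = gbar →
      ∀ ν : ZH, (∀ r : ℕ, 0 < r → ℓ.Coprime r → ∃ μ : ZH, μ ^ r = ν) → Z ν * g * (T ν)⁻¹ = g → ν = 1 := by
    intro g hg ν hν hfix
    refine hfree g.left g.right ?_ ν hν ((act_eq_self_iff U K ν g).mp hfix)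
    rw [SemidirectProduct.inl_left_mul_inr_right]; exact hg
  haveI : Finite (Ext i ⧸ V.toSubgroup) := Subgroup.quotient_finite_of_isOpen _ V.toOpenSubgroup.isOpen
  -- the affine permutation at level `V` and the period of `ḡ`
  set σV := (Equiv.mulRight (QuotientGroup.mk' V.toSubgroup τ)⁻¹).trans
    (Equiv.mulLeft (QuotientGroup.mk' V.toSubgroup z)) with hσV
  set n := Function.minimalPeriod σV gbar with hndef
  have hn0 : n ≠ 0 := by
    have hfun : (fun y : Ext i ⧸ V.toSubgroup => σV • y) = ⇑σV := funext fun y => Equiv.Perm.smul_def σV y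
    have := (MulAction.minimalPeriod_pos (a := σV) (b := gbar)).ne
    rwa [hfun] at this
  obtain ⟨a, r, hr, hnar⟩ := Nat.exists_eq_pow_mul_and_not_dvd hn0 ℓ hℓ.out.ne_one
  -- every lift of `ḡ` has, at some finer level, period divisible by `ℓ · n`
  have hlift : ∀ g : Ext i, QuotientGroup.mk' V.toSubgroup g = gbar → ∃ V₁ : OpenNormalSubgroup (Ext i), ℓ * n ∣
      Function.minimalPeriod ((Equiv.mulRight (QuotientGroup.mk' V₁.toSubgroup τ)⁻¹).trans
        (Equiv.mulLeft (QuotientGroup.mk' V₁.toSubgroup z))) (QuotientGroup.mk' V₁.toSubgroup g) := by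
    intro g hg
    obtain ⟨V₀, hV₀⟩ := exists_openNormal_pow_dvd_minimalPeriod hℓ.out Z T g (hfreeE g hg) (a + 1)
    refine ⟨V₀ ⊓ V, ?_⟩
    have h1 := minimalPeriod_map_dvd (inf_le_left : V₀ ⊓ V ≤ V₀) z τ (QuotientGroup.mk' _ g)
    have h2 := minimalPeriod_map_dvd (inf_le_right : V₀ ⊓ V ≤ V) z τ (QuotientGroup.mk' _ g)
    rw [map_mk'_eq inf_le_left] at h1
    rw [map_mk'_eq inf_le_right] at h2
    rw [hZ1, hT1] at hV₀
    have h3 : ℓ ^ (a + 1) ∣ _ := dvd_trans hV₀ h1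
    have h4 : r ∣ _ := dvd_trans (Dvd.intro_left _ hnar.symm) (dvd_trans (hndef ▸ hg ▸ dvd_rfl) h2)
    have hcop : (ℓ ^ (a + 1)).Coprime r :=
      (Nat.Coprime.pow_left _ ((Nat.Prime.coprime_iff_not_dvd hℓ.out).mpr hr))
    have h5 := hcop.mul_dvd_of_dvd_of_dvd h3 h4
    have hln : ℓ * n = ℓ ^ (a + 1) * r := by rw [hnar, pow_succ]; ring
    rwa [hln]
  obtain ⟨V', hle, hV'⟩ := exists_openNormal_forall_fibre_dvd V z τ gbar (ℓ * n) hlift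
  -- the Fox homomorphism at level `V'`
  haveI : Finite (Ext i ⧸ V'.toSubgroup) := Subgroup.quotient_finite_of_isOpen _ V'.toOpenSubgroup.isOpen
  letI : Fintype (Ext i ⧸ V'.toSubgroup) := Fintype.ofFinite _
  letI : TopologicalSpace (W (Ext i ⧸ V'.toSubgroup) (ZMod ℓ)) := ⊥
  haveI : DiscreteTopology (W (Ext i ⧸ V'.toSubgroup) (ZMod ℓ)) := ⟨rfl⟩
  haveI : Finite (W (Ext i ⧸ V'.toSubgroup) (ZMod ℓ)) := finite_W
  set α' : Ext i ⧸ V'.toSubgroup := QuotientGroup.mk' V'.toSubgroup (SemidirectProduct.inl genA) with hα'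
  set β' : Ext i ⧸ V'.toSubgroup := QuotientGroup.mk' V'.toSubgroup (SemidirectProduct.inl genB) with hβ'
  obtain ⟨Φ', hΦ'a, hΦ'b⟩ := exists_fox (k := ZMod ℓ) α' β'
  -- (i) compatibility: `f_V = push ρ f_{V'}`
  set ρ := QuotientGroup.map V'.toSubgroup V.toSubgroup (MonoidHom.id _) (le_comap_id_of_le hle) with hρ
  letI : Fintype (Ext i ⧸ V.toSubgroup) := Fintype.ofFinite _
  have hpush := fox_fst_eq_push hΦa hΦb hΦ'a hΦ'b ρ (map_mk'_eq hle _) (map_mk'_eq hle _) x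
  -- (ii) invariance of `f_{V'}` under `σ̄'`
  set σ' := (Equiv.mulRight (QuotientGroup.mk' V'.toSubgroup τ)⁻¹).trans
    (Equiv.mulLeft (QuotientGroup.mk' V'.toSubgroup z)) with hσ'
  have hinv : ∀ h, (Multiplicative.toAdd (Φ' x).left).1 (σ' h) = (Multiplicative.toAdd (Φ' x).left).1 h := by
    -- exponents at this level
    set N : ℕ+ := ⟨Nat.card (W (Ext i ⧸ V'.toSubgroup) (ZMod ℓ)), Nat.card_pos⟩ with hN
    have hNpow : ∀ w : W (Ext i ⧸ V'.toSubgroup) (ZMod ℓ), w ^ (N : ℕ) = 1 := fun w => pow_card_eq_one'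
    have hκ := fox_bPow_eq_pow hΦ'b N hNpow (kk ^ i)
    have huu := fox_bPow_eq_pow hΦ'b N hNpow u
    set nκ := (Multiplicative.toAdd (ZHatLevel.level N (kk ^ i))).val
    set nu := (Multiplicative.toAdd (ZHatLevel.level N u)).val
    let πc : Ext i →ₜ* Ext i ⧸ V'.toSubgroup := ⟨QuotientGroup.mk' V'.toSubgroup, QuotientGroup.continuous_mk⟩
    let φ' : F₂hatT →ₜ* Ext i ⧸ V'.toSubgroup := πc.comp ⟨SemidirectProduct.inl, continuous_inl i⟩
    have hright : ∀ y, (Φ' y).right = QuotientGroup.mk' V'.toSubgroup (SemidirectProduct.inl y) :=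
      fun y => fox_right_eq hΦ'a hΦ'b (φ := φ') rfl rfl y
    have hβu : QuotientGroup.mk' V'.toSubgroup (SemidirectProduct.inl (bPow u)) = β' ^ nu := by
      rw [← hright, huu, wb_pow_right]
    have hβκ : QuotientGroup.mk' V'.toSubgroup (SemidirectProduct.inl (bPow (kk ^ i))) = β' ^ nκ := by
      rw [← hright, hκ, wb_pow_right]
    set γ : (Ext i ⧸ V'.toSubgroup) ≃* (Ext i ⧸ V'.toSubgroup) :=
      MulAut.conj (QuotientGroup.mk' V'.toSubgroup (SemidirectProduct.inr kk)) with hγ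
    have hγa : γ α' = α' * β' ^ nκ := by rw [hγ, hα', conj_mk_inr_genA, hβκ]
    have hγb : γ β' = β' := by rw [hγ, hβ', conj_mk_inr_genB]
    intro h
    have key := fox_fst_invariant_of_shear_eq_conj hΦ'a hΦ'b (kk ^ i) u P γ nκ nu hγa hγb hκ huu
      (x := x) (by rw [← shear_apply, ← shearPow_apply]; exact hx) h
    rw [← key, hσ', affine_apply, hγ, MulAut.conj_apply, ← hβu, hz, hτ, map_mul]
    group
  -- (iii) the orbit count at level `V'`
  rw [hpush, push_apply]
  have hsemi := semiconj_map_affine hle z τ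
  have hper : Function.IsPeriodicPt σV n gbar := Function.isPeriodicPt_minimalPeriod σV gbar
  refine sum_eq_zero_of_dvd_minimalPeriod (ZMod.natCast_self ℓ) (σ' ^ n) _ (fun h => ?_)
    (Multiplicative.toAdd (Φ' x).left).1 (fun h => ?_) ?_
  · simp only [Finset.mem_filter, Finset.mem_univ, true_and, Equiv.Perm.coe_pow]
    rw [(hsemi.iterate_right n).eq h]
    constructor
    · intro hh; rw [hh]; exact hper
    · intro hh
      exact (σV ^ n).injective (by rw [Equiv.Perm.coe_pow]; exact hh.trans hper.symm)
  · rw [← zpow_natCast]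
    exact apply_zpow_eq_of_invariant σ' hinv n h
  · intro h hh
    simp only [Finset.mem_filter, Finset.mem_univ, true_and] at hh
    have hdiv := hV' h hh
    rw [Equiv.Perm.coe_pow, Function.minimalPeriod_iterate_eq_div_gcd hn0]
    have hn' : n ∣ Function.minimalPeriod σ' h := dvd_trans (Dvd.intro_left ℓ rfl) hdiv
    rw [Nat.gcd_eq_right hn']
    exact Nat.dvd_div_of_mul_dvd (by rwa [mul_comm] at hdiv)

/-! ### §3 The two `Ẑ`-measure theorems -/

/-- **FREE EVERYWHERE ⇒ `x ∈ Π_e = b^Ẑ`** (VANISH at every point of every level; read-out 1 gives `x̄ ∈ ⟨β⟩`;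
`⋂_V b^Ẑ V = b^Ẑ`). [cite: MochizukiAbsTopII2013, Prop 1.3 (viii) p.12] -/
theorem mem_nodeGp_of_shear_eq_conj_of_free {ℓ : ℕ} [hℓ : Fact ℓ.Prime] (U K : ZH →ₜ* ZH) (P : ZH) {x : F₂hatT}
    (hx : shearPow i (K (iotaZ (Multiplicative.ofAdd 1))) x =
      (bPow (U (iotaZ (Multiplicative.ofAdd 1))))⁻¹ * x * bPow P)
    (hfree : ∀ (y : F₂hatT) (ν : ZH), (∀ r : ℕ, 0 < r → ℓ.Coprime r → ∃ μ : ZH, μ ^ r = ν) →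
      bPow (U ν) * shearPow i (K ν) y = y → ν = 1) :
    x ∈ nodeGp := by
  classical
  change x ∈ bAxis
  refine mem_of_forall_exists_inl_inv_mul_mem (i := i) isClosed_bAxis fun V => ?_
  haveI : Finite (Ext i ⧸ V.toSubgroup) := Subgroup.quotient_finite_of_isOpen _ V.toOpenSubgroup.isOpen
  letI : Fintype (Ext i ⧸ V.toSubgroup) := Fintype.ofFinite _
  letI : TopologicalSpace (W (Ext i ⧸ V.toSubgroup) (ZMod ℓ)) := ⊥
  haveI : DiscreteTopology (W (Ext i ⧸ V.toSubgroup) (ZMod ℓ)) := ⟨rfl⟩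
  haveI : Finite (W (Ext i ⧸ V.toSubgroup) (ZMod ℓ)) := finite_W
  obtain ⟨Φ, hΦa, hΦb⟩ := exists_fox (k := ZMod ℓ) (QuotientGroup.mk' V.toSubgroup (SemidirectProduct.inl genA))
    (QuotientGroup.mk' V.toSubgroup (SemidirectProduct.inl genB))
  have hf0 : (Multiplicative.toAdd (Φ x).left).1 = 0 := by
    funext gbar
    exact fox_fst_apply_eq_zero_of_free U K P hx V hΦa hΦb gbar (fun y s _ ν hν hfix => hfree y ν hν hfix)
  have hmem := right_mem_zpowers_of_fst_eq_zero hΦa hΦb x hf0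
  let πc : Ext i →ₜ* Ext i ⧸ V.toSubgroup := ⟨QuotientGroup.mk' V.toSubgroup, QuotientGroup.continuous_mk⟩
  let φ : F₂hatT →ₜ* Ext i ⧸ V.toSubgroup := πc.comp ⟨SemidirectProduct.inl, continuous_inl i⟩
  rw [fox_right_eq hΦa hΦb (φ := φ) rfl rfl x] at hmem
  obtain ⟨j, hj⟩ := Subgroup.mem_zpowers_iff.mp hmem
  refine ⟨genB ^ j, Subgroup.zpow_mem _ eta_of_one_mem_bAxis j, QuotientGroup.eq.mp ?_⟩
  change QuotientGroup.mk' V.toSubgroup (SemidirectProduct.inl (genB ^ j)) =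
    QuotientGroup.mk' V.toSubgroup (SemidirectProduct.inl x)
  rw [map_zpow, map_zpow]
  exact hj

/-- **FREE OFF `Π_v` ⇒ `x ∈ Π_v` OR `x ∈ Π_v·a·b^Ẑ`** (VANISH off the image `Q` of `Π_v ⋊ Ẑ`; read-out 2 gives
`x̄ ∈ Q ∪ Qα⟨β⟩`; `⋂_V` of the closed set `(Π_v⋊Ẑ) ∪ (Π_v⋊Ẑ)(a,1)(b^Ẑ,1)`). [cite: MochizukiAbsTopII2013, Prop 1.3 (viii) p.12] -/
theorem mem_vertGp_or_of_shear_eq_conj_of_free_off {ℓ : ℕ} [hℓ : Fact ℓ.Prime] (U K : ZH →ₜ* ZH) (P : ZH)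
    {x : F₂hatT} (hx : shearPow i (K (iotaZ (Multiplicative.ofAdd 1))) x =
      (bPow (U (iotaZ (Multiplicative.ofAdd 1))))⁻¹ * x * bPow P)
    (hfree : ∀ (y : F₂hatT), y ∉ vertGp → ∀ ν : ZH, (∀ r : ℕ, 0 < r → ℓ.Coprime r → ∃ μ : ZH, μ ^ r = ν) →
      bPow (U ν) * shearPow i (K ν) y = y → ν = 1) :
    x ∈ vertGp ∨ ∃ p ∈ vertGp, ∃ t : ZH, x = p * genA * bPow t := by
  classical
  -- `Π_v ⋊ Ẑ ≤ Π_I`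
  let Dv : Subgroup (Ext i) :=
    { carrier := {g | g.left ∈ vertGp}
      one_mem' := by show (1 : Ext i).left ∈ vertGp; rw [SemidirectProduct.one_left]; exact vertGp.one_mem
      mul_mem' := fun {g g'} hg hg' => by
        show (g * g').left ∈ vertGp
        rw [SemidirectProduct.mul_left]
        exact vertGp.mul_mem hg (shearPow_mem_vertGp_of_mem i _ _ hg')
      inv_mem' := fun {g} hg => by
        show g⁻¹.left ∈ vertGp
        rw [SemidirectProduct.inv_left]
        exact shearPow_mem_vertGp_of_mem i _ _ (vertGp.inv_mem hg) }
  have hDvcl : IsClosed (Dv : Set (Ext i)) := by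
    change IsClosed ((fun g : Ext i => g.left) ⁻¹' (vertGp : Set F₂hatT))
    exact (Subgroup.isClosed_topologicalClosure _).preimage ((continuous_leftRight i).fst)
  -- the closed target set `K = Dv ∪ Dv·(a,1)·(b^Ẑ,1)`
  set Kset : Set (Ext i) := (Dv : Set (Ext i)) ∪
    (fun q : Ext i × F₂hatT => q.1 * SemidirectProduct.inl genA * SemidirectProduct.inl q.2) '' ((Dv : Set (Ext i)) ×ˢ
      (bAxis : Set F₂hatT)) with hKset
  have hKcl : IsClosed Kset := by
    refine hDvcl.union (IsCompact.isClosed ?_)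
    refine (hDvcl.isCompact.prod isClosed_bAxis.isCompact).image ?_
    exact (continuous_fst.mul continuous_const).mul ((continuous_inl i).comp continuous_snd)
  have hmem : (SemidirectProduct.inl x : Ext i) ∈ Kset := by
    refine mem_of_forall_exists_inv_mul_mem hKcl fun V => ?_
    haveI : Finite (Ext i ⧸ V.toSubgroup) := Subgroup.quotient_finite_of_isOpen _ V.toOpenSubgroup.isOpen
    letI : Fintype (Ext i ⧸ V.toSubgroup) := Fintype.ofFinite _
    letI : TopologicalSpace (W (Ext i ⧸ V.toSubgroup) (ZMod ℓ)) := ⊥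
    haveI : DiscreteTopology (W (Ext i ⧸ V.toSubgroup) (ZMod ℓ)) := ⟨rfl⟩
    haveI : Finite (W (Ext i ⧸ V.toSubgroup) (ZMod ℓ)) := finite_W
    set π := QuotientGroup.mk' V.toSubgroup with hπ
    obtain ⟨Φ, hΦa, hΦb⟩ := exists_fox (k := ZMod ℓ) (π (SemidirectProduct.inl genA)) (π (SemidirectProduct.inl genB))
    set Q : Subgroup (Ext i ⧸ V.toSubgroup) := Dv.map π with hQ
    have hβQ : π (SemidirectProduct.inl genB) ∈ Q :=
      Subgroup.mem_map_of_mem π (show (SemidirectProduct.inl genB : Ext i).left ∈ vertGp by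
        rw [SemidirectProduct.left_inl]; exact genB_mem_vertGp)
    have hoff : ∀ h, h ∉ Q → (Multiplicative.toAdd (Φ x).left).1 h = 0 := by
      intro h hh
      refine fox_fst_apply_eq_zero_of_free U K P hx V hΦa hΦb h fun y s hys ν hν hfix => hfree y ?_ ν hν hfix
      intro hy
      apply hh
      rw [← hys]
      exact Subgroup.mem_map_of_mem π (show (SemidirectProduct.inl y * SemidirectProduct.inr s : Ext i).left ∈ vertGp by
        simpa using hy)
    have hro := right_mem_or_exists_of_fst_eq_zero_off hΦa hΦb Q hβQ x hoff
    let πc : Ext i →ₜ* Ext i ⧸ V.toSubgroup := ⟨π, QuotientGroup.continuous_mk⟩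
    let φ : F₂hatT →ₜ* Ext i ⧸ V.toSubgroup := πc.comp ⟨SemidirectProduct.inl, continuous_inl i⟩
    rw [fox_right_eq hΦa hΦb (φ := φ) rfl rfl x] at hro
    change π (SemidirectProduct.inl x) ∈ Q ∨ ∃ q₀ ∈ Q, ∃ j : ℤ, π (SemidirectProduct.inl x) = q₀ * _ * _ ^ j at hro
    rcases hro with hxQ | ⟨q₀, hq₀, j, hj⟩
    · obtain ⟨d, hd, hdx⟩ := Subgroup.mem_map.mp hxQ
      exact ⟨d, Or.inl hd, QuotientGroup.eq.mp hdx⟩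
    · obtain ⟨d, hd, hdq⟩ := Subgroup.mem_map.mp hq₀
      refine ⟨d * SemidirectProduct.inl genA * SemidirectProduct.inl (genB ^ j),
        Or.inr ⟨(d, genB ^ j), ⟨hd, Subgroup.zpow_mem _ eta_of_one_mem_bAxis j⟩, rfl⟩, QuotientGroup.eq.mp ?_⟩
      change π (d * SemidirectProduct.inl genA * SemidirectProduct.inl (genB ^ j)) = π (SemidirectProduct.inl x)
      rw [map_mul, map_mul, map_zpow, hdq]
      exact hj.symm
  rcases hmem with hxD | ⟨⟨d, s⟩, ⟨hd, hs⟩, hds⟩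
  · left
    have h := hxD
    change (SemidirectProduct.inl x : Ext i).left ∈ vertGp at h
    rwa [SemidirectProduct.left_inl] at h
  · right
    have hright := congrArg SemidirectProduct.right hds
    simp only [SemidirectProduct.mul_right, SemidirectProduct.right_inl, mul_one] at hright
    have hleft := congrArg SemidirectProduct.left hds
    simp only [SemidirectProduct.mul_left, SemidirectProduct.mul_right, SemidirectProduct.left_inl,
      SemidirectProduct.right_inl, hright, map_one, MulAut.one_apply, mul_one] at hleft
    obtain ⟨t, rfl⟩ := (mem_bAxis_iff s).mp hs
    exact ⟨d.left, hd, t, hleft.symm⟩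
end Literature.AnabelianGeometry.AbsoluteAnabelian.AbsTopII.DehnTwist
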